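import Summits.AtomisticToContinuum.Crystallization.Theorems.FreeSplittingCertificatesRadiusLadderFarkas
import Summits.AtomisticToContinuum.Crystallization.Theorems.FreeSplittingCertificatesFreePairSplitting
import Summits.AtomisticToContinuum.Crystallization.Theorems.FreeSplittingCertificatesSlackDensity

/-!
# `FiniteRangeSplitting` (stmt-AtomisticToContinuum-12559): no refutation without recurrence

Companion of `FreeSplittingCertificatesRadiusLadder` / `…RadiusLadderFarkas` (block-2b unit `b2b-freesplit-A`,
gen 6).  VALUE = a theorem about the recurrent-pattern LP falsifier of the radius ladder (RESULTS-R2 §6 P2a made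
kernel-checked) — NOT summit progress; nothing here closes an item.

Recall (`rungAt_iff_finitelyFeasible`, `exists_zoo_of_not_rungAt`, `not_rungAt_of_zoo`): the rung
`RungAt δ R` (a radius-`R` pair-splitting rule feasible on all `δ`-separated configurations) fails iff some FINITE
ZOO `Z` of `δ`-separated configurations admits no rule feasible on all of its sites.  The LP behind that test has
one variable per REALISED BOND KEY `(x_j - x_i, T_ij)` (bond vector, joint `R`-pattern `bondPattern R x i j`),
and the only coupling between two site rows is a key that occurs in both (a RECURRENCE) — complementarity couples
a key only with the key of the reversed bond, which is its `Key.conj` (`zkey_rev`).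

* `Conf`, `Bond`, `Bond.rev`, `zbonds Z` (the ordered bonds `(c, i, j)`, `i ≠ j`, of the zoo), `zkey R b`
  (the realised key of a bond) and `RecurrenceFree R Z` (the realised keys are pairwise distinct over `zbonds Z`,
  i.e. `Set.InjOn (zkey R) (zbonds Z)`);
* `exists_feasibleOn_of_recurrenceFree` : on a recurrence-free zoo of injective configurations there is a RULE
  feasible at every site of every configuration, at every radius `R` — glue the free pair splittings `w^c` of
  `FreePairSplitting` (`freePairSplitting_proof`, in the tree) into one rule: `Φ(key of (c,i,j)) := w^c_{ij}`,
  `Φ := 1/2` off the realised keys; recurrence-freeness makes this single-valued, `zkey_rev` makes it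
  complementary, and each site row is then literally the free-splitting inequality of that site;
* `not_refuting_of_recurrenceFree` / `exists_recurrence_of_refuting` : hence a zoo in the hypothesis shape of
  `not_rungAt_of_zoo` (no rule feasible on it) contains two distinct ordered bonds with the same realised key;
* `exists_recurrence_of_not_rungAt` : every non-rung `¬ RungAt δ R` (`0 < δ`) is witnessed by a finite zoo, and
  every witnessing zoo has a recurrence;
* `recurrenceFree_singleton_of_diam_le` / `exists_feasibleOn_singleton_of_diam_le` : a single configuration read
  at a radius `R ≥` its diameter is recurrence-free (its patterns are the whole configuration recentred, and
  recentred copies of a finite set determine the centre), so ONE configuration never refutes a rung `R ≥ diam`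
  — the "fixed zoo, `R → ∞`" row of the ladder table (RESULTS-R2 §0b) as a theorem.

So every refutation of every rung is an identity between realised joint patterns of distinct bonds: the
combinatorial content of the lane's LP (RESULTS-R2 §1, "recurrent-pattern LP") is NECESSARY, not a modelling
choice, and configuration families without recurrences at radius `R` (generic clusters, generic perturbations of
anything) are dead as refuters of the rung `R` before any LP is run (§6 P2a; the class-balance refinement P2/P6 is
`…RadiusLadderFarkasBalance`).
-/

noncomputable section
namespace Summit.AtomisticToContinuum.Crystallization.Theorems.StrictSplittingRuleBirth

open scoped BigOperators Classical
open Literature.MathematicalPhysics.StatisticalMechanics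

/-- Euclidean `3`-space. -/
local notation "E3" => EuclideanSpace ℝ (Fin 3)

/-! ## Zoos, ordered bonds and realised keys -/

/-- A configuration of a zoo: a particle number and the positions (the element type of the zoos of
`not_rungAt_of_zoo` / `exists_zoo_of_not_rungAt`). [folklore] -/
abbrev Conf := Σ N : ℕ, Fin N → EuclideanSpace ℝ (Fin 3)

/-- An ordered bond of a zoo: a configuration and an ordered pair of its site labels. [folklore] -/
abbrev Bond := Σ c : Conf, Fin c.1 × Fin c.1

/-- The reversed bond `(c, j, i)` of `(c, i, j)`. [folklore] -/
def Bond.rev (b : Bond) : Bond := ⟨b.1, (b.2.2, b.2.1)⟩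

/-- Reversing a bond twice gives it back. -/
theorem Bond.rev_rev (b : Bond) : b.rev.rev = b := rfl

/-- Reversal is injective. -/
theorem Bond.rev_injective : Function.Injective Bond.rev := fun b b' h => by
  rw [← Bond.rev_rev b, ← Bond.rev_rev b', h]

/-- The ordered bonds of a zoo `Z`: triples `(c, i, j)` with `c ∈ Z` and `i ≠ j`. [folklore] -/
def zbonds (Z : Finset Conf) : Finset Bond :=
  Z.sigma fun c => (Finset.univ : Finset (Fin c.1 × Fin c.1)).filter fun p => p.1 ≠ p.2

/-- Membership in `zbonds`. -/
theorem mem_zbonds {Z : Finset Conf} {b : Bond} : b ∈ zbonds Z ↔ b.1 ∈ Z ∧ b.2.1 ≠ b.2.2 := by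
  simp [zbonds, Finset.mem_sigma]

/-- `zbonds` is closed under reversal. -/
theorem rev_mem_zbonds {Z : Finset Conf} {b : Bond} (hb : b ∈ zbonds Z) : b.rev ∈ zbonds Z := by
  rw [mem_zbonds] at hb ⊢
  exact ⟨hb.1, fun h => hb.2 h.symm⟩

/-- The REALISED KEY of the ordered bond `(c, i, j)` at radius `R`: bond vector `x_j - x_i` and joint pattern
`bondPattern R x i j` — the argument pair `siteE R Φ x i` hands to the rule for this bond. [folklore] -/
def zkey (R : ℝ) (b : Bond) : Key :=
  (b.1.2 b.2.2 - b.1.2 b.2.1, bondPattern R b.1.2 b.2.1 b.2.2)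

/-- **The key of the reversed bond is the conjugate key**: `zkey R (c,j,i) = (zkey R (c,i,j)).conj` — realised
patterns are complementary, `T_ij - (x_j - x_i) = T_ji` (the landed `slackDensity_pattern_swap`, =
`core_bondPattern_swap` of `…StrictSplittingRuleCoreHall`, read through `bondPattern`). -/
theorem zkey_rev (R : ℝ) (b : Bond) : zkey R b.rev = (zkey R b).conj := by
  obtain ⟨⟨N, x⟩, i, j⟩ := b
  have hswap : (bondPattern R x i j).image (fun u => u - (x j - x i)) = bondPattern R x j i :=
    slackDensity_pattern_swap R x i j
  simp only [zkey, Bond.rev, Key.conj, neg_sub, hswap]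

/-- A zoo is RECURRENCE-FREE at radius `R` when its realised keys are pairwise distinct over its ordered bonds
(`Set.InjOn (zkey R) (zbonds Z)`): no joint `R`-pattern of a bond recurs at another bond of the zoo. [folklore] -/
def RecurrenceFree (R : ℝ) (Z : Finset Conf) : Prop :=
  ∀ b ∈ zbonds Z, ∀ b' ∈ zbonds Z, zkey R b = zkey R b' → b = b'

/-- `RecurrenceFree` is `Set.InjOn`. -/
theorem recurrenceFree_iff_injOn (R : ℝ) (Z : Finset Conf) :
    RecurrenceFree R Z ↔ Set.InjOn (zkey R) ↑(zbonds Z) :=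
  ⟨fun h _ hb _ hb' hk => h _ hb _ hb' hk, fun h _ hb _ hb' hk => h hb hb' hk⟩

/-! ## Gluing free pair splittings into one rule -/

/-- **No refutation without recurrence.**  On a recurrence-free zoo of injective configurations there is, at
every radius `R`, a pair-splitting RULE feasible at every site of every configuration of the zoo: the free pair
splittings of `FreePairSplitting` (one per configuration, `freePairSplitting_proof`) glue into a single rule
because no realised key is shared. -/
theorem exists_feasibleOn_of_recurrenceFree (R : ℝ) (Z : Finset Conf)
    (hZ : ∀ c ∈ Z, Function.Injective c.2) (hfree : RecurrenceFree R Z) :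
    ∃ Φ : E3 → Finset E3 → ℝ, IsRule Φ ∧ ∀ c ∈ Z, ∀ i : Fin c.1, eInf ≤ siteE R Φ c.2 i := by
  classical
  -- one free pair splitting per configuration of the zoo
  have hfps := freePairSplitting_proof
  choose w hw using fun c : {c // c ∈ Z} => hfps c.1.1 c.1.2 (hZ c.1 c.2)
  -- the weight of an ordered bond
  let W : Bond → ℝ := fun b => if h : b.1 ∈ Z then w ⟨b.1, h⟩ b.2.1 b.2.2 else 1 / 2
  have hWrev : ∀ b ∈ zbonds Z, W b + W b.rev = 1 := by
    intro b hb
    obtain ⟨hc, hij⟩ := mem_zbonds.1 hb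
    simp only [W, Bond.rev, dif_pos hc]
    exact ((hw ⟨b.1, hc⟩).1 _ _ hij).2
  have hWbox : ∀ b ∈ zbonds Z, 0 ≤ W b ∧ W b ≤ 1 := by
    intro b hb
    obtain ⟨hc, hij⟩ := mem_zbonds.1 hb
    have h1 := ((hw ⟨b.1, hc⟩).1 _ _ hij).1
    have h2 := ((hw ⟨b.1, hc⟩).1 _ _ (Ne.symm hij)).1
    have h3 := hWrev b hb
    simp only [W, Bond.rev, dif_pos hc] at h3 ⊢
    exact ⟨h1, by linarith⟩
  -- the glued rule, as a function of keys
  let Ψ : Key → ℝ := fun k => if h : ∃ b ∈ zbonds Z, zkey R b = k then W (Classical.choose h) else 1 / 2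
  have hΨkey : ∀ b ∈ zbonds Z, Ψ (zkey R b) = W b := by
    intro b hb
    have h : ∃ b' ∈ zbonds Z, zkey R b' = zkey R b := ⟨b, hb, rfl⟩
    simp only [Ψ, dif_pos h]
    obtain ⟨hb', hk⟩ := Classical.choose_spec h
    rw [hfree _ hb' _ hb hk]
  have hΨfree : ∀ k : Key, (¬ ∃ b ∈ zbonds Z, zkey R b = k) → Ψ k = 1 / 2 := fun k hk => by
    simp only [Ψ, dif_neg hk]
  have hΨbox : ∀ k : Key, 0 ≤ Ψ k ∧ Ψ k ≤ 1 := by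
    intro k
    by_cases h : ∃ b ∈ zbonds Z, zkey R b = k
    · obtain ⟨b, hb, rfl⟩ := h
      rw [hΨkey b hb]
      exact hWbox b hb
    · rw [hΨfree k h]
      norm_num
  have hΨconj : ∀ k : Key, Ψ k + Ψ k.conj = 1 := by
    intro k
    by_cases h : ∃ b ∈ zbonds Z, zkey R b = k
    · obtain ⟨b, hb, rfl⟩ := h
      rw [← zkey_rev, hΨkey b hb, hΨkey b.rev (rev_mem_zbonds hb)]
      exact hWrev b hb
    · have h' : ¬ ∃ b ∈ zbonds Z, zkey R b = k.conj := by
        rintro ⟨b, hb, hk⟩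
        refine h ⟨b.rev, rev_mem_zbonds hb, ?_⟩
        rw [zkey_rev, hk, Key.conj_conj]
      rw [hΨfree k h, hΨfree _ h']
      norm_num
  refine ⟨fun v T => Ψ (v, T), ⟨fun v T => hΨbox (v, T), fun v T _ => hΨconj (v, T)⟩, ?_⟩
  -- each site row is the free-splitting inequality of that site
  intro c hc i
  rw [perturbative_siteE_eq]
  have hrow := (hw ⟨c, hc⟩).2 i
  have hterm : ∀ j ∈ Finset.univ.erase i,
      Ψ (c.2 j - c.2 i, bondPattern R c.2 i j) * lennardJones (dist (c.2 i) (c.2 j)) =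
        w ⟨c, hc⟩ i j * lennardJones (dist (c.2 i) (c.2 j)) := by
    intro j hj
    have hij : i ≠ j := (Finset.ne_of_mem_erase hj).symm
    have hb : (⟨c, (i, j)⟩ : Bond) ∈ zbonds Z := mem_zbonds.2 ⟨hc, hij⟩
    have hk := hΨkey _ hb
    simp only [zkey] at hk
    rw [hk]
    simp only [W, dif_pos hc]
  rw [Finset.sum_congr rfl hterm]
  exact hrow

/-- The `Sep`-flavoured form (the zoos of the ladder are `δ`-separated, `0 < δ`). -/
theorem exists_feasibleOn_of_recurrenceFree_sep {δ : ℝ} (hδ : 0 < δ) (R : ℝ) (Z : Finset Conf)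
    (hsep : ∀ c ∈ Z, Sep δ c.2) (hfree : RecurrenceFree R Z) :
    ∃ Φ : E3 → Finset E3 → ℝ, IsRule Φ ∧ ∀ c ∈ Z, ∀ i : Fin c.1, eInf ≤ siteE R Φ c.2 i :=
  exists_feasibleOn_of_recurrenceFree R Z (fun c hc => perturbative_injective_of_sep hδ (hsep c hc)) hfree

/-! ## Every refutation is a recurrence -/

/-- A recurrence-free zoo refutes nothing: it is never in the hypothesis shape of `not_rungAt_of_zoo`. -/
theorem not_refuting_of_recurrenceFree (R : ℝ) {Z : Finset Conf} (hZ : ∀ c ∈ Z, Function.Injective c.2)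
    (hfree : RecurrenceFree R Z) :
    ¬ ∀ Φ : E3 → Finset E3 → ℝ, IsRule Φ → ∃ c ∈ Z, ∃ i : Fin c.1, siteE R Φ c.2 i < eInf := by
  intro href
  obtain ⟨Φ, hr, hf⟩ := exists_feasibleOn_of_recurrenceFree R Z hZ hfree
  obtain ⟨c, hc, i, hlt⟩ := href Φ hr
  exact (not_lt.mpr (hf c hc i)) hlt

/-- **Every refuting zoo has a recurrence**: if no rule is feasible on the (injective) configurations of `Z` at
radius `R`, then two distinct ordered bonds of `Z` realise the same key. -/
theorem exists_recurrence_of_refuting (R : ℝ) {Z : Finset Conf} (hZ : ∀ c ∈ Z, Function.Injective c.2)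
    (href : ∀ Φ : E3 → Finset E3 → ℝ, IsRule Φ → ∃ c ∈ Z, ∃ i : Fin c.1, siteE R Φ c.2 i < eInf) :
    ∃ b ∈ zbonds Z, ∃ b' ∈ zbonds Z, b ≠ b' ∧ zkey R b = zkey R b' := by
  by_contra h
  refine not_refuting_of_recurrenceFree R hZ (fun b hb b' hb' hk => ?_) href
  by_contra hne
  exact h ⟨b, hb, b', hb', hne, hk⟩

/-- **Every non-rung is witnessed by a recurrence**: `¬ RungAt δ R` (`0 < δ`) gives a finite zoo of
`δ`-separated configurations on which no rule is feasible (`exists_zoo_of_not_rungAt`), and any such zoo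
contains two distinct ordered bonds with the same realised key. -/
theorem exists_recurrence_of_not_rungAt {δ R : ℝ} (hδ : 0 < δ) (h : ¬ RungAt δ R) :
    ∃ Z : Finset Conf, (∀ c ∈ Z, Sep δ c.2) ∧
      (∀ Φ : E3 → Finset E3 → ℝ, IsRule Φ → ∃ c ∈ Z, ∃ i : Fin c.1, siteE R Φ c.2 i < eInf) ∧
      ∃ b ∈ zbonds Z, ∃ b' ∈ zbonds Z, b ≠ b' ∧ zkey R b = zkey R b' := by
  obtain ⟨Z, hsep, href⟩ := exists_zoo_of_not_rungAt h
  exact ⟨Z, hsep, href,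
    exists_recurrence_of_refuting R (fun c hc => perturbative_injective_of_sep hδ (hsep c hc)) href⟩

/-! ## One configuration never refutes a rung beyond its diameter -/

/-- At a radius `R ≥` the diameter of `x`, every joint pattern is the whole configuration recentred:
`bondPattern R x i j = {x_l - x_i : l}`. -/
theorem bondPattern_of_diam_le {R : ℝ} {N : ℕ} {x : Fin N → E3} (hR : ∀ i j : Fin N, dist (x i) (x j) ≤ R)
    (i j : Fin N) : bondPattern R x i j = Finset.univ.image fun l => x l - x i := by
  unfold bondPattern
  congr 1
  exact Finset.filter_true_of_mem fun l _ => Or.inl (hR l i)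

/-- Recentred copies of an injective finite configuration determine the centre:
`{x_l - x_i : l} = {x_l - x_i' : l} → i = i'` (compare the sums). -/
theorem eq_of_image_sub_eq {N : ℕ} {x : Fin N → E3} (hx : Function.Injective x) {i i' : Fin N}
    (h : (Finset.univ.image fun l => x l - x i) = Finset.univ.image fun l => x l - x i') : i = i' := by
  have hs : ∀ k : Fin N, ∑ u ∈ Finset.univ.image (fun l => x l - x k), u = ∑ l, x l - (N : ℝ) • x k := by
    intro k
    rw [Finset.sum_image fun l _ l' _ hl => hx (sub_left_injective hl), Finset.sum_sub_distrib,
      Finset.sum_const, Finset.card_univ, Fintype.card_fin, ← Nat.cast_smul_eq_nsmul ℝ]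
  have h1 := hs i
  rw [h, hs i'] at h1
  have hN : (N : ℝ) ≠ 0 := by
    have : 0 < N := Fin.pos i
    exact_mod_cast this.ne'
  have h2 : (N : ℝ) • x i = (N : ℝ) • x i' := by
    have := sub_right_injective h1.symm
    exact this.symm ▸ rfl
  exact hx (smul_right_injective E3 hN h2)

/-- **A single configuration is recurrence-free beyond its diameter.** -/
theorem recurrenceFree_singleton_of_diam_le {R : ℝ} (c : Conf) (hc : Function.Injective c.2)
    (hR : ∀ i j : Fin c.1, dist (c.2 i) (c.2 j) ≤ R) : RecurrenceFree R {c} := by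
  obtain ⟨N, x⟩ := c
  intro b hb b' hb' hk
  obtain ⟨c₁, i, j⟩ := b
  obtain ⟨c₂, i', j'⟩ := b'
  obtain ⟨h₁, -⟩ := mem_zbonds.1 hb
  obtain ⟨h₂, -⟩ := mem_zbonds.1 hb'
  simp only [Finset.mem_singleton] at h₁ h₂
  subst h₁
  subst h₂
  simp only [zkey, Prod.mk.injEq] at hk
  obtain ⟨hv, hT⟩ := hk
  rw [bondPattern_of_diam_le hR, bondPattern_of_diam_le hR] at hT
  have hii' : i = i' := eq_of_image_sub_eq hc hT
  subst hii'
  have hjj' : j = j' := hc (sub_left_injective hv)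
  subst hjj'
  rfl

/-- **One configuration never refutes a rung `R ≥` its diameter**: some rule is feasible at all of its sites
(the free pair splitting of the configuration, read as a rule). -/
theorem exists_feasibleOn_singleton_of_diam_le {R : ℝ} (c : Conf) (hc : Function.Injective c.2)
    (hR : ∀ i j : Fin c.1, dist (c.2 i) (c.2 j) ≤ R) :
    ∃ Φ : E3 → Finset E3 → ℝ, IsRule Φ ∧ ∀ i : Fin c.1, eInf ≤ siteE R Φ c.2 i := by
  obtain ⟨Φ, hr, hf⟩ := exists_feasibleOn_of_recurrenceFree R {c} (fun c' hc' => by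
    rw [Finset.mem_singleton] at hc'
    subst hc'
    exact hc) (recurrenceFree_singleton_of_diam_le c hc hR)
  exact ⟨Φ, hr, hf c (Finset.mem_singleton_self c)⟩

end Summit.AtomisticToContinuum.Crystallization.Theorems.StrictSplittingRuleBirth

end
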